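import Summits.CriticalPhenomena.PercolationContinuityZ3.Theorems.Transplant.SkelSignHoldsAll
import Summits.CriticalPhenomena.PercolationContinuityZ3.Theorems.Transplant.Zd2SkeletonConc
import Literature.Probability.Percolation.BoundedDegreeCriticalProb
import Literature.Probability.Percolation.UnionJack
import HarnessLib

/-!
# The UNION-JACK (tetrakis square, centred square) lattice at its own BOND critical point — a two-type planar customer of the
# D″ node with finite cylinders

builds on p205010 (kernel theorem, internal audit signed; external expert review pending): the row runs through the multi-type D″ node
`samePDropOfSkeletonSign_holds` (`SkelSignHoldsAll`), whose closure uses near-one gluing (`AdditiveGluing`), which builds on p205010.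
Status sentence (coordinator 2026-08-20T04:30Z): "θ(p_c) = 0 on ℤ^d, all d ≥ 2 — kernel-verified (Lean 4/Mathlib, standard axioms); internal
adversarial audit SIGNED 2026-08-20 04:29Z; external expert review pending."
Lane `prim-bschramm`, seat `prim-bschramm-p2` (gen 14; class C1b by INPUT SUBSTITUTION); helper file (`--supports stmt-CriticalPhenomena-4575 --as helper`).

THE OBSERVATION.  `PlanarSkeletonSign` does not ask for a third dimension: with `φ = id` on a graph whose vertex set IS `ℤ²` the
cylinders are the finite boxes `Λ_ℓ + t`, so Φ2 (`CylSubcritical`) holds at EVERY density (a finite graph never percolates, cf. the refuter's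
`zd2SkeletonConc`) and `PlanarSkeletonSign.criticalContinuity'` gives `θ(p_c) = 0` outright.  The bond structures on `ℤ²` with sup-norm-`1`
bonds containing the nearest-neighbour bonds and symmetric under the central inversion and an axis flip about every vertex are `ℤ²`
(Harris–Kesten), the king's graph (`King.king_criticalContinuity`, p4-g9) and — the only one that is not a Cayley graph of `ℤ²` — the
**tetrakis square tiling = Union-Jack (centred square) lattice**: `ℤ²` plus the four diagonal bonds at every EVEN site; degrees `8`/`4`; a
planar triangulation, dual of `(4,8²)`; the tree's `unionJackGraph` (Beffara's `G_s` on `MixedSite = ℤ² ⊕ ℤ²`, `UnionJack.lean`).  Its bond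
critical value is not known in closed form (`≈ 0.3232`); `θ^{bond}(p_c) = 0` is in substance within Kesten's 1982 matching-pair theory for
symmetric periodic planar lattices (no explicit statement in print).

* §1 `Tetrakis.graph` (coordinate model on `ℤ²`), its automorphisms, `Tetrakis.skeleton : PlanarSkeletonSign Tetrakis.graph` (types `0`,
  `e₀`), `Tetrakis.skeleton_cylSubcritical`, **`Tetrakis.criticalContinuity : θ_T(v, p_c(T, v)) = 0`**, `Tetrakis.conj4_hypotheses`;
* §2 `Tetrakis.isoUnionJack : Tetrakis.graph ≃g unionJackGraph`, **`unionJack_criticalContinuity`**, `unionJack_conj4_hypotheses`.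
[cite: KozmaNitzan2024, §4 p. 16 (Lemma 8)] [cite: BenjaminiSchramm1996, Conj. 4] [cite: Kesten1982, §3.3 Thm. 3.1] [cite: Beffara2008Universal, §5.1]
-/

noncomputable section

namespace Summit.CriticalPhenomena.PercolationContinuityZ3.Theorems.Transplant

open MeasureTheory Literature.Probability.Percolation Literature.Probability.LatticeModels SimpleGraph
open Literature.Barriers.CriticalPhenomena (IsQuasiTransitive MixedSite)

/-! ## §0 The axis flip as a bijection -/

/-- The axis flip `(a, b) ↦ (a, -b)` as a bijection of `ℤ²` (an involution, `flipSnd_flipSnd`). [folklore] -/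
def flipSndEquiv : Site 2 ≃ Site 2 := ⟨flipSnd, flipSnd, flipSnd_flipSnd, flipSnd_flipSnd⟩

/-- `flipSnd 0 = 0`. [folklore] -/
@[simp] theorem flipSnd_zero : flipSnd (0 : Site 2) = 0 := by
  funext i; fin_cases i <;> simp [flipSnd]

/-! ## §1 The tetrakis square tiling (coordinate model) -/

namespace Tetrakis

/-- **The tetrakis square tiling** on `ℤ²`: the nearest-neighbour bonds of `ℤ²` together with the four diagonal bonds at every EVEN site
(`x₀ + x₁` even) — equivalently one diagonal per face, of alternating orientation; vertex degrees `8` (even sites) and `4` (odd sites); a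
planar triangulation, the dual of the truncated square tiling `(4,8²)`. [cite: Kesten1982, §3.3 Thm. 3.1 (periodic planar lattices with axes of symmetry)] -/
def graph : SimpleGraph (Site 2) where
  Adj x y := (zdGraph 2).Adj x y ∨ (Even (x 0 + x 1) ∧ Even (y 0 + y 1) ∧ |x 0 - y 0| = 1 ∧ |x 1 - y 1| = 1)
  symm.symm x y h := by
    rcases h with h | ⟨hx, hy, h0, h1⟩
    · exact Or.inl h.symm
    · exact Or.inr ⟨hy, hx, by rw [abs_sub_comm]; exact h0, by rw [abs_sub_comm]; exact h1⟩
  loopless.irrefl x h := by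
    rcases h with h | ⟨-, -, h0, -⟩
    · exact h.ne rfl
    · simp at h0

/-- Adjacency in the tetrakis tiling, unfolded. [folklore] -/
theorem adj_iff (x y : Site 2) :
    graph.Adj x y ↔ (zdGraph 2).Adj x y ∨ (Even (x 0 + x 1) ∧ Even (y 0 + y 1) ∧ |x 0 - y 0| = 1 ∧ |x 1 - y 1| = 1) := Iff.rfl

/-- Adjacency in the tetrakis tiling is decidable. [folklore] -/
instance : DecidableRel graph.Adj := fun x y => decidable_of_iff _ (adj_iff x y).symm

/-- `ℤ²` is a spanning subgraph of the tetrakis tiling. [folklore] -/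
theorem zdGraph_le_graph : zdGraph 2 ≤ graph := fun _ _ h => Or.inl h

/-- Bonds of the tetrakis tiling have sup-norm range `1`. [folklore] -/
theorem abs_sub_le_one_of_adj {x y : Site 2} (h : graph.Adj x y) (i : Fin 2) : |x i - y i| ≤ 1 := by
  rcases h with h | ⟨-, -, h0, h1⟩
  · obtain ⟨j, hj | hj⟩ := (zdGraph_adj_iff x y).1 h
    · rw [hj]; by_cases hij : i = j
      · subst hij; simp
      · simp [hij]
    · rw [hj]; by_cases hij : i = j
      · subst hij; simp
      · simp [hij]
  · fin_cases i
    · exact le_of_eq h0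
    · exact le_of_eq h1

/-- A neighbour differs by a vector of the unit box `Λ₁`. [folklore] -/
theorem sub_mem_box_of_adj {x y : Site 2} (h : graph.Adj x y) : y - x ∈ box 2 1 := by
  rw [mem_box]
  intro i
  have := abs_sub_le_one_of_adj h i
  rw [abs_le] at this
  simp only [Pi.sub_apply, Nat.cast_one]
  constructor <;> omega

/-- The tetrakis tiling is locally finite: the neighbours of `x` lie in `x + Λ₁`. [folklore] -/
instance instLocallyFinite : graph.LocallyFinite := fun x =>
  Fintype.ofFinset (((box 2 1).image fun v => x + v).filter fun y => graph.Adj x y) (by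
    intro y
    simp only [Finset.mem_filter, Finset.mem_image, mem_neighborSet, and_iff_right_iff_imp]
    exact fun h => ⟨y - x, sub_mem_box_of_adj h, by abel⟩)

/-- Every site of the tetrakis tiling has at most `|Λ₁|` neighbours. [folklore] -/
theorem degree_le (x : Site 2) : graph.degree x ≤ (box 2 1).card := by
  classical
  rw [← card_neighborFinset_eq_degree]
  calc (graph.neighborFinset x).card ≤ ((box 2 1).image fun v => x + v).card := by
        refine Finset.card_le_card fun y hy => ?_
        rw [mem_neighborFinset] at hy
        exact Finset.mem_image.2 ⟨y - x, sub_mem_box_of_adj hy, by abel⟩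
    _ ≤ (box 2 1).card := Finset.card_image_le

/-- Translations by EVEN vectors are automorphisms of the tetrakis tiling. [folklore] -/
def shiftIso {v : Site 2} (hv : Even (v 0 + v 1)) : graph ≃g graph where
  toEquiv := Site.shift v
  map_rel_iff' := by
    intro a b
    rw [adj_iff, adj_iff, zdGraph_adj_shift_iff]
    simp only [Site.shift_apply, Pi.add_apply, add_sub_add_right_eq_sub]
    obtain ⟨r, hr⟩ := hv
    have ha : Even (a 0 + v 0 + (a 1 + v 1)) ↔ Even (a 0 + a 1) := by
      simp only [Int.even_iff]; omega
    have hb : Even (b 0 + v 0 + (b 1 + v 1)) ↔ Even (b 0 + b 1) := by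
      simp only [Int.even_iff]; omega
    rw [ha, hb]

/-- `shiftIso hv x = x + v`. [folklore] -/
@[simp] theorem shiftIso_apply {v : Site 2} (hv : Even (v 0 + v 1)) (x : Site 2) : shiftIso hv x = x + v := rfl

/-- The central inversion about an arbitrary site `c`, `x ↦ 2c - x` (it preserves the parity of `x₀ + x₁`), is an automorphism of the
tetrakis tiling. [folklore] -/
def negIso (c : Site 2) : graph ≃g graph where
  toEquiv := ⟨fun x => c + c - x, fun x => c + c - x, fun x => by simp, fun x => by simp⟩
  map_rel_iff' := by
    intro a b
    show graph.Adj (c + c - a) (c + c - b) ↔ graph.Adj a b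
    rw [adj_iff, adj_iff, zdGraph_adj_iff, zdGraph_adj_iff, Fin.exists_fin_two, Fin.exists_fin_two]
    simp only [Site.eq_iff_two, Pi.sub_apply, Pi.add_apply, Pi.single_eq_same,
      Pi.single_eq_of_ne (show (1 : Fin 2) ≠ 0 by decide), Pi.single_eq_of_ne (show (0 : Fin 2) ≠ 1 by decide), add_zero,
      Int.even_iff, abs_eq (zero_le_one' ℤ)]
    omega

/-- The axis flip `(a, b) ↦ (a, -b)` is an automorphism of the tetrakis tiling (it fixes `0` and `e₀`). [folklore] -/
def flipIso : graph ≃g graph where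
  toEquiv := flipSndEquiv
  map_rel_iff' := by
    intro a b
    show graph.Adj (flipSnd a) (flipSnd b) ↔ graph.Adj a b
    rw [adj_iff, adj_iff, zdGraph_adj_iff, zdGraph_adj_iff, Fin.exists_fin_two, Fin.exists_fin_two]
    simp only [Site.eq_iff_two, Pi.add_apply, flipSnd_apply_zero, flipSnd_apply_one, Pi.single_eq_same,
      Pi.single_eq_of_ne (show (1 : Fin 2) ≠ 0 by decide), Pi.single_eq_of_ne (show (0 : Fin 2) ≠ 1 by decide), add_zero,
      Int.even_iff, abs_eq (zero_le_one' ℤ)]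
    omega

/-- **The tetrakis tiling carries a `PlanarSkeletonSign` with the identity skeleton map**: two base vertices `0` (even) and `e₀` (odd),
frames = even translations, central inversions `negIso 0`, `negIso e₀`, the axis flip `flipIso` (fixing both base vertices), degree
`≤ |Λ₁|`, outward unit steps, connected finite cylinders `Λ_ℓ + t`. [cite: KozmaNitzan2024, §4 p. 16 (Lemma 8: the lattice symmetries)] -/
def skeleton : PlanarSkeletonSign graph where
  φ := fun x => x
  lip := fun _ _ h i => abs_sub_le_one_of_adj h i
  types := {0, Pi.single 0 1}
  frame := by
    intro v
    rcases Int.even_or_odd (v 0 + v 1) with hv | hv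
    · exact ⟨0, by simp, shiftIso hv, by simp, fun w => by simp⟩
    · have hv' : Even ((v - Pi.single 0 1 : Site 2) 0 + (v - Pi.single 0 1 : Site 2) 1) := by
        obtain ⟨r, hr⟩ := hv; exact ⟨r, by simp; omega⟩
      refine ⟨Pi.single 0 1, by simp, shiftIso hv', ?_, fun w => ?_⟩
      · show Pi.single 0 1 + (v - Pi.single 0 1) = v; abel
      · show w + (v - Pi.single 0 1) = w + (v - Pi.single 0 1); rfl
  neg := by
    intro t ht
    refine ⟨negIso t, ?_, fun w => ?_⟩
    · show t + t - t = t; abel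
    · show (t + t - w) - t = -(w - t); abel
  Δ := (box 2 1).card
  degree_le := degree_le
  step := by
    intro v i σ
    refine ⟨v + Pi.single i (σ : ℤ), zdGraph_le_graph ?_, rfl⟩
    rw [zdGraph_adj_iff]
    rcases Int.units_eq_one_or σ with h | h
    · exact ⟨i, Or.inl (by rw [h]; rfl)⟩
    · refine ⟨i, Or.inr ?_⟩
      rw [h, add_assoc, ← Pi.single_add]
      simp
  cyl_connected := by
    intro t _ ℓ _
    -- the cylinder at `t` is the translate `t + Λ_ℓ`; translate the connected box of `ℤ²`
    have e : {w : Site 2 | w - t ∈ box 2 ℓ} = (fun w => w + t) '' (↑(box 2 ℓ) : Set (Site 2)) := by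
      ext w
      simp only [Set.mem_setOf_eq, Set.mem_image, Finset.mem_coe]
      constructor
      · intro h; exact ⟨w - t, h, by abel⟩
      · rintro ⟨u, hu, rfl⟩; simpa using hu
    rw [e]
    haveI : Nonempty ((fun w => w + t) '' (↑(box 2 ℓ) : Set (Site 2))) := ⟨⟨0 + t, 0, Finset.mem_coe.2 (zero_mem_box 2 ℓ), rfl⟩⟩
    refine SimpleGraph.Connected.mk fun a b => ?_
    obtain ⟨a₀, ha₀, hae⟩ := a.2
    obtain ⟨b₀, hb₀, hbe⟩ := b.2
    have h := box_induce_reachable ℓ (Finset.mem_coe.1 ha₀) (Finset.mem_coe.1 hb₀)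
    -- transport along the translation `w ↦ w + t` (an isomorphism `ℤ² ≃g ℤ²` carrying the box onto its translate)
    have hmap : ∀ {x y : Site 2} (hx : x ∈ (↑(box 2 ℓ) : Set (Site 2))) (hy : y ∈ (↑(box 2 ℓ) : Set (Site 2))),
        ((zdGraph 2).induce (↑(box 2 ℓ) : Set (Site 2))).Reachable ⟨x, hx⟩ ⟨y, hy⟩ →
          (graph.induce ((fun w => w + t) '' (↑(box 2 ℓ) : Set (Site 2)))).Reachable ⟨x + t, x, hx, rfl⟩ ⟨y + t, y, hy, rfl⟩ := by
      intro x y hx hy hr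
      let ψ : (zdGraph 2).induce (↑(box 2 ℓ) : Set (Site 2)) →g graph.induce ((fun w => w + t) '' (↑(box 2 ℓ) : Set (Site 2))) :=
        { toFun := fun z => ⟨z.1 + t, z.1, z.2, rfl⟩
          map_rel' := fun {z z'} hzz' => by
            simp only [comap_adj, Function.Embedding.subtype_apply] at hzz' ⊢
            exact zdGraph_le_graph ((zdGraph_adj_shift_iff t z.1 z'.1).2 hzz') }
      exact hr.map ψ
    have := hmap ha₀ hb₀ h
    have ea : (⟨a₀ + t, a₀, ha₀, rfl⟩ : ((fun w => w + t) '' (↑(box 2 ℓ) : Set (Site 2)))) = a := Subtype.ext hae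
    have eb : (⟨b₀ + t, b₀, hb₀, rfl⟩ : ((fun w => w + t) '' (↑(box 2 ℓ) : Set (Site 2)))) = b := Subtype.ext hbe
    rw [ea, eb] at this
    exact this
  flip := by
    intro t ht
    refine ⟨flipIso, ?_, fun w => ?_⟩
    · simp only [Finset.mem_insert, Finset.mem_singleton] at ht
      rcases ht with rfl | rfl
      · exact flipSnd_zero
      · show flipSnd (Pi.single 0 1) = Pi.single 0 1
        funext i; fin_cases i <;> simp [flipSnd]
    · simp only [Finset.mem_insert, Finset.mem_singleton] at ht
      show flipSnd w - t = flipSnd (w - t)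
      rcases ht with rfl | rfl
      · simp
      · funext i; fin_cases i <;> simp [flipSnd]

/-- The skeleton map of `Tetrakis.skeleton` is the identity. [folklore] -/
@[simp] theorem skeleton_φ (x : Site 2) : skeleton.φ x = x := rfl

/-- **Finite cylinders never percolate**: `Tetrakis.skeleton.CylSubcritical p` at EVERY density `p`. [folklore] -/
theorem skeleton_cylSubcritical (p : unitInterval) : skeleton.CylSubcritical p := by
  intro t _ ℓ
  haveI : Finite ↥(skeleton.cyl t ℓ) := by
    have hfin : (skeleton.cyl t ℓ).Finite := by
      have : skeleton.cyl t ℓ = (fun w => w + t) '' (↑(box 2 ℓ) : Set (Site 2)) := by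
        ext w
        simp only [PlanarSkeletonNeg.cyl, skeleton_φ, Set.mem_setOf_eq, Set.mem_image, Finset.mem_coe]
        constructor
        · intro h; exact ⟨w - t, h, by abel⟩
        · rintro ⟨u, hu, rfl⟩; simpa using hu
      rw [this]
      exact (box 2 ℓ).finite_toSet.image _
    exact hfin.to_subtype
  exact Literature.Probability.Percolation.theta_eq_zero_of_finite _ _ _

/-- **THEOREM: bond percolation on the tetrakis square tiling dies at its own critical point**, at every vertex:
`θ_T(v, p_c(T, v)) = 0` (D″ node, identity skeleton with two base types, Φ2 free).  builds on p205010 (kernel theorem, internal audit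
signed; external expert review pending).  A planar triangulation with the symmetries of the square: in substance within Kesten's 1982
matching-pair theory (no explicit statement in print). [cite: BenjaminiSchramm1996, Conj. 4] [cite: Kesten1982, §3.3 Thm. 3.1]
[cite: KozmaNitzan2024, §1 p. 2 (approach 1)] -/
theorem criticalContinuity (v : Site 2) : theta graph v (criticalProbIOf graph v) = 0 :=
  PlanarSkeletonSign.criticalContinuity' graph skeleton (fun _ _ => skeleton_cylSubcritical _) v

/-- **The tetrakis tiling meets every hypothesis of Conjecture 4**: connected, quasi-transitive, `0 < p_c < 1`. [cite: BenjaminiSchramm1996, Conj. 4] -/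
theorem conj4_hypotheses :
    graph.Connected ∧ IsQuasiTransitive graph ∧ ∀ v : Site 2, 0 < criticalProb graph v ∧ criticalProb graph v < 1 :=
  ⟨skeleton.toPlanarSkeletonNeg.graph_connected 0, skeleton.toPlanarSkeletonNeg.isQuasiTransitive,
    fun v => ⟨criticalProb_pos_of_degree_le graph degree_le v, skeleton.criticalProb_lt_one v⟩⟩

/-! ## §2 The coordinate model is the tree's Union-Jack lattice `unionJackGraph` -/

/-- To Beffara's `G_s`: even sites to type-I sites, odd sites to face centres (the picture rotated by `π/4`). [cite: Beffara2008Universal, §5.1] -/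
def toMixed (x : Site 2) : MixedSite :=
  if Even (x 0 + x 1) then Sum.inl ((x 0 - x 1) / 2, (x 0 + x 1) / 2) else Sum.inr ((x 0 - x 1 - 1) / 2, (x 0 + x 1 - 1) / 2)

/-- From Beffara's `G_s`: type-I site `(a, b)` ↦ even site `(a + b, b - a)`, face centre `(k, l)` ↦ odd site `(k + l + 1, l - k)`. [cite: Beffara2008Universal, §5.1] -/
def ofMixed : MixedSite → Site 2
  | Sum.inl q => ![q.1 + q.2, q.2 - q.1]
  | Sum.inr f => ![f.1 + f.2 + 1, f.2 - f.1]

/-- `toMixed` on an even site. [folklore] -/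
theorem toMixed_of_even {x : Site 2} (h : Even (x 0 + x 1)) : toMixed x = Sum.inl ((x 0 - x 1) / 2, (x 0 + x 1) / 2) := by
  rw [toMixed, if_pos h]

/-- `toMixed` on an odd site. [folklore] -/
theorem toMixed_of_odd {x : Site 2} (h : Odd (x 0 + x 1)) :
    toMixed x = Sum.inr ((x 0 - x 1 - 1) / 2, (x 0 + x 1 - 1) / 2) := by
  rw [toMixed, if_neg (Int.not_even_iff_odd.2 h)]

/-- `ofMixed (toMixed x) = x`. [folklore] -/
theorem ofMixed_toMixed (x : Site 2) : ofMixed (toMixed x) = x := by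
  rcases Int.even_or_odd (x 0 + x 1) with h | h
  · rw [toMixed_of_even h, ofMixed]
    obtain ⟨r, hr⟩ := h
    exact Site.eq_iff_two.2 ⟨by simp; omega, by simp; omega⟩
  · rw [toMixed_of_odd h, ofMixed]
    obtain ⟨r, hr⟩ := h
    exact Site.eq_iff_two.2 ⟨by simp; omega, by simp; omega⟩

/-- `toMixed (ofMixed u) = u`. [folklore] -/
theorem toMixed_ofMixed (u : MixedSite) : toMixed (ofMixed u) = u := by
  rcases u with ⟨a, b⟩ | ⟨k, l⟩
  · have h : Even ((![a + b, b - a] : Site 2) 0 + (![a + b, b - a] : Site 2) 1) := ⟨b, by simp; ring⟩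
    rw [ofMixed, toMixed_of_even h]
    congr 1
    simp only [Matrix.cons_val_zero, Matrix.cons_val_one, Prod.mk.injEq]
    constructor <;> omega
  · have h : Odd ((![k + l + 1, l - k] : Site 2) 0 + (![k + l + 1, l - k] : Site 2) 1) := ⟨l, by simp; ring⟩
    rw [ofMixed, toMixed_of_odd h]
    congr 1
    simp only [Matrix.cons_val_zero, Matrix.cons_val_one, Prod.mk.injEq]
    constructor <;> omega

/-- The vertex bijection of the coordinate model with `MixedSite`. [folklore] -/
def mixedEquiv : Site 2 ≃ MixedSite := ⟨toMixed, ofMixed, ofMixed_toMixed, toMixed_ofMixed⟩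

/-- Adjacency of the coordinate model in coordinates. [folklore] -/
private theorem adj_iff_coord (x y : Site 2) :
    graph.Adj x y ↔
      ((y 0 = x 0 + 1 ∧ y 1 = x 1) ∨ (x 0 = y 0 + 1 ∧ y 1 = x 1) ∨ (y 1 = x 1 + 1 ∧ y 0 = x 0) ∨ (x 1 = y 1 + 1 ∧ y 0 = x 0)) ∨
        ((x 0 + x 1) % 2 = 0 ∧ (y 0 + y 1) % 2 = 0 ∧ (x 0 - y 0 = 1 ∨ x 0 - y 0 = -1) ∧ (x 1 - y 1 = 1 ∨ x 1 - y 1 = -1)) := by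
  rw [adj_iff, zdGraph_two_adj_iff, Int.even_iff, Int.even_iff, abs_eq (zero_le_one' ℤ), abs_eq (zero_le_one' ℤ)]

/-- Adjacency is preserved by `toMixed` — the case of an even first site. [cite: Beffara2008Universal, §5.1] -/
private theorem toMixed_adj_iff_of_even {x : Site 2} (hx : Even (x 0 + x 1)) (y : Site 2) :
    unionJackGraph.Adj (toMixed x) (toMixed y) ↔ graph.Adj x y := by
  rw [adj_iff_coord]
  obtain ⟨r, hr⟩ := id hx
  have e1 : (x 0 - x 1) / 2 = r - x 1 := by omega
  have e2 : (x 0 + x 1) / 2 = r := by omega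
  rcases Int.even_or_odd (y 0 + y 1) with hy | hy
  · rw [toMixed_of_even hx, toMixed_of_even hy, unionJackGraph_adj_inl_inl]
    obtain ⟨s, hs⟩ := hy
    have e3 : (y 0 - y 1) / 2 = s - y 1 := by omega
    have e4 : (y 0 + y 1) / 2 = s := by omega
    simp only [e1, e2, e3, e4, Prod.mk.injEq]
    omega
  · rw [toMixed_of_even hx, toMixed_of_odd hy, unionJackGraph_adj_inl_inr]
    obtain ⟨s, hs⟩ := hy
    have e3 : (y 0 - y 1 - 1) / 2 = s - y 1 := by omega
    have e4 : (y 0 + y 1 - 1) / 2 = s := by omega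
    simp only [e1, e2, e3, e4]
    omega

/-- **Adjacency is preserved by `toMixed`**: `ℤ²`-bonds of `G_s` are our even–even diagonal bonds, centre–corner bonds our
nearest-neighbour bonds, and there are no centre–centre / odd–odd bonds. [cite: Beffara2008Universal, §5.1] -/
theorem toMixed_adj_iff (x y : Site 2) : unionJackGraph.Adj (toMixed x) (toMixed y) ↔ graph.Adj x y := by
  rcases Int.even_or_odd (x 0 + x 1) with hx | hx
  · exact toMixed_adj_iff_of_even hx y
  rcases Int.even_or_odd (y 0 + y 1) with hy | hy
  · rw [unionJackGraph.adj_comm, graph.adj_comm]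
    exact toMixed_adj_iff_of_even hy x
  · obtain ⟨r, hr⟩ := id hx; obtain ⟨s, hs⟩ := id hy
    rw [toMixed_of_odd hx, toMixed_of_odd hy, adj_iff_coord]
    constructor
    · intro h
      exact absurd h (unionJackGraph_not_adj_inr_inr ((x 0 - x 1 - 1) / 2, (x 0 + x 1 - 1) / 2)
        ((y 0 - y 1 - 1) / 2, (y 0 + y 1 - 1) / 2))
    · intro h
      exfalso
      omega

/-- **`Tetrakis.graph ≃g unionJackGraph`**: the coordinate model IS the tree's Union-Jack lattice `G_s` (even sites = type-I sites,
odd sites = face centres). [cite: Beffara2008Universal, §5.1] -/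
def isoUnionJack : graph ≃g unionJackGraph where
  toEquiv := mixedEquiv
  map_rel_iff' := fun {a b} => toMixed_adj_iff a b

end Tetrakis

/-- **THEOREM: bond percolation on the Union-Jack (centred square / tetrakis) lattice `unionJackGraph` dies at its own critical point**,
at every site `u : MixedSite` — `Tetrakis.criticalContinuity` transported along `Tetrakis.isoUnionJack` (`theta_iso`, `criticalProb_iso`).
builds on p205010 (kernel theorem, internal audit signed; external expert review pending). [cite: BenjaminiSchramm1996, Conj. 4]
[cite: Beffara2008Universal, §5.1 (G_s)] [cite: Kesten1982, §3.3 Thm. 3.1] -/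
theorem unionJack_criticalContinuity (u : MixedSite) : theta unionJackGraph u (criticalProbIOf unionJackGraph u) = 0 := by
  set x := Tetrakis.ofMixed u with hx
  have hu : Tetrakis.isoUnionJack x = u := Tetrakis.toMixed_ofMixed u
  have hθ := theta_iso Tetrakis.isoUnionJack x (criticalProbIOf unionJackGraph u)
  have hpc : criticalProbIOf unionJackGraph u = criticalProbIOf Tetrakis.graph x :=
    Subtype.ext (by rw [← hu]; exact criticalProb_iso Tetrakis.isoUnionJack x)
  rw [hu] at hθ
  rw [hθ, hpc]
  exact Tetrakis.criticalContinuity x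

/-- **The Union-Jack lattice meets every hypothesis of Conjecture 4** (transported along `isoUnionJack`). [cite: BenjaminiSchramm1996, Conj. 4] -/
theorem unionJack_conj4_hypotheses :
    unionJackGraph.Connected ∧ IsQuasiTransitive unionJackGraph ∧
      ∀ u : MixedSite, 0 < criticalProb unionJackGraph u ∧ criticalProb unionJackGraph u < 1 := by
  obtain ⟨hconn, ⟨V₀, hV₀⟩, hpc⟩ := Tetrakis.conj4_hypotheses
  refine ⟨(Iso.connected_iff Tetrakis.isoUnionJack).1 hconn, ⟨V₀.image Tetrakis.isoUnionJack, fun u => ?_⟩, fun u => ?_⟩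
  · obtain ⟨γ, hγ⟩ := hV₀ (Tetrakis.isoUnionJack.symm u)
    refine ⟨(Tetrakis.isoUnionJack.symm.trans γ).trans Tetrakis.isoUnionJack, Finset.mem_image.2 ⟨_, hγ, rfl⟩⟩
  · have e : criticalProb unionJackGraph u = criticalProb Tetrakis.graph (Tetrakis.isoUnionJack.symm u) := by
      rw [← criticalProb_iso Tetrakis.isoUnionJack (Tetrakis.isoUnionJack.symm u), RelIso.apply_symm_apply]
    rw [e]
    exact hpc _

end Summit.CriticalPhenomena.PercolationContinuityZ3.Theorems.Transplant

end
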